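import Mathlib
import Summits.Ventures.PercRepro2.ThreeMarkTyped
import Summits.Ventures.PercRepro2.ThreeMarkOne

/-!
# The typed (3M1): its two-copy kernel, the bilinear form, and `ThreeMarkOneCount → ThreeMarkOne`
(blind cell PercRepro2, night-3 g23, 2026-08-28; `proofs/NIGHT3-CERT.md` §32.6, §32.15)

(3M1) = `PointSplit.ThreeMarkOne` is `(3M) + 2·S₁` with `S₁ = m(110)m(101) − m(100)m(111)` the
`{v ∈ C(a₂)}`-class BHK slack of `(h, o)`.  Its two-copy kernel is therefore g22's (3M) kernel
`threeMarkKernel` plus twice the CLASS KERNEL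

  `K_S(x, y) = I₁₁₀(x)I₁₀₁(y) − I₁₀₀(x)I₁₁₁(y) + I₁₁₀(y)I₁₀₁(x) − I₁₀₀(y)I₁₁₁(x)`

(`I_{χωβ}` the indicator of `Q ∩ cell(χ, ω, β)`; `classKernel`), whose bilinear form is the
polarised class slack (`biForm_classKernel`), so `biForm p p threeMarkOneKernel = 2·(3M1)-slack`
(`biForm_threeMarkOneKernel`).  The typed candidate **`ThreeMarkOneCount`** (every complementary-pair
count of `threeMarkOneKernel` on every minor is `≥ 0`; NOT claimed proved) implies (3M1) by p1's
`disSum_nonneg_of_pinnedCount` at `F = ∅` (`threeMarkOne_of_threeMarkOneCount`).  Census (night-3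
g23, own C code `tm1_abstr.c` on g22's abstract merge model, the count being half the pinned count):
**0 negative on all 1,980,014,055 abstract instances with ≤ 9 mixed edges** (a ≤ 6 local; a = 7, 8, 9
kits j317425, j317428, j318051), so (3M1) holds on every finite graph whenever ≤ 9 edges carry a weight
strictly between 0 and 1 (computation theorem, the reduction being this file).  Own work; standard
axioms.
-/

namespace Summit.Ventures.PercRepro2

open UnionCluster

namespace CovForm

namespace RootEdge

variable {V : Type*} {E : Type*} [Fintype E] [DecidableEq E] [DecidableEq V]
  {R : Type*} [Field R] [LinearOrder R] [IsStrictOrderedRing R]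

/-- **The class kernel** of the `{v ∈ C(a₂)}`-class BHK slack of `(h, o)`:
`K_S(x, y) = I₁₁₀(x)I₁₀₁(y) − I₁₀₀(x)I₁₁₁(y) + I₁₁₀(y)I₁₀₁(x) − I₁₀₀(y)I₁₁₁(x)`. -/
noncomputable def classKernel (ends : E → Sym2 V) (a₁ a₂ b o v : V) (x y : Config E) : R :=
  (avoidAll ends a₂ {a₁} ∩ cellSet ends a₁ a₂ b o v true true false).indicator 1 x *
      (avoidAll ends a₂ {a₁} ∩ cellSet ends a₁ a₂ b o v true false true).indicator 1 y -
    (avoidAll ends a₂ {a₁} ∩ cellSet ends a₁ a₂ b o v true false false).indicator 1 x *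
      (avoidAll ends a₂ {a₁} ∩ cellSet ends a₁ a₂ b o v true true true).indicator 1 y +
    ((avoidAll ends a₂ {a₁} ∩ cellSet ends a₁ a₂ b o v true true false).indicator 1 y *
      (avoidAll ends a₂ {a₁} ∩ cellSet ends a₁ a₂ b o v true false true).indicator 1 x -
    (avoidAll ends a₂ {a₁} ∩ cellSet ends a₁ a₂ b o v true false false).indicator 1 y *
      (avoidAll ends a₂ {a₁} ∩ cellSet ends a₁ a₂ b o v true true true).indicator 1 x)

/-- **The (3M1) kernel**: the (3M) kernel plus twice the class kernel. -/
noncomputable def threeMarkOneKernel (ends : E → Sym2 V) (a₁ a₂ b o v : V) (x y : Config E) : R :=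
  threeMarkKernel ends a₁ a₂ b o v x y + 2 * classKernel ends a₁ a₂ b o v x y

omit [DecidableEq V] [LinearOrder R] [IsStrictOrderedRing R] in
/-- **The bilinear form of the class kernel** is the polarised class slack:
`biForm q q′ K_S = [m_q(110)m_{q′}(101) − m_q(100)m_{q′}(111)] + [m_{q′}(110)m_q(101) −
m_{q′}(100)m_q(111)]`. -/
theorem biForm_classKernel (q q' : E → R) (ends : E → Sym2 V) (a₁ a₂ b o v : V) :
    biForm q q' (classKernel ends a₁ a₂ b o v) =
      (cell q ends a₁ a₂ b o v true true false * cell q' ends a₁ a₂ b o v true false true -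
          cell q ends a₁ a₂ b o v true false false * cell q' ends a₁ a₂ b o v true true true) +
        (cell q' ends a₁ a₂ b o v true true false * cell q ends a₁ a₂ b o v true false true -
          cell q' ends a₁ a₂ b o v true false false * cell q ends a₁ a₂ b o v true true true) := by
  have swap : ∀ (A B : Set (Config E)),
      prob q' A * prob q B = ∑ x : Config E, ∑ y : Config E,
        weight q x * weight q' y * (A.indicator 1 y * B.indicator 1 x) := by
    intro A B
    simp only [prob_eq_expect_indicator, expect, Finset.sum_mul_sum]
    rw [Finset.sum_comm]
    refine Finset.sum_congr rfl fun x _ => Finset.sum_congr rfl fun y _ => ?_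
    ring
  have direct : ∀ (A B : Set (Config E)),
      prob q A * prob q' B = ∑ x : Config E, ∑ y : Config E,
        weight q x * weight q' y * (A.indicator 1 x * B.indicator 1 y) := by
    intro A B
    simp only [prob_eq_expect_indicator, expect, Finset.sum_mul_sum]
    refine Finset.sum_congr rfl fun x _ => Finset.sum_congr rfl fun y _ => ?_
    ring
  simp only [cell, direct, swap, biForm]
  simp only [← Finset.sum_add_distrib, ← Finset.sum_sub_distrib]
  refine Finset.sum_congr rfl fun x _ => Finset.sum_congr rfl fun y _ => ?_
  unfold classKernel
  ring

omit [DecidableEq V] [LinearOrder R] [IsStrictOrderedRing R] in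
/-- `biForm` is additive in the kernel (local copy). -/
lemma biForm_add_kernel (q q' : E → R) (K₁ K₂ : Config E → Config E → R) :
    biForm q q' (fun x y => K₁ x y + K₂ x y) = biForm q q' K₁ + biForm q q' K₂ := by
  unfold biForm
  rw [← Finset.sum_add_distrib]
  refine Finset.sum_congr rfl fun x _ => ?_
  rw [← Finset.sum_add_distrib]
  refine Finset.sum_congr rfl fun y _ => ?_
  ring

omit [DecidableEq V] [LinearOrder R] [IsStrictOrderedRing R] in
/-- Scalars come out of `biForm`. -/
lemma biForm_smul_kernel (q q' : E → R) (c : R) (K : Config E → Config E → R) :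
    biForm q q' (fun x y => c * K x y) = c * biForm q q' K := by
  unfold biForm
  rw [Finset.mul_sum]
  refine Finset.sum_congr rfl fun x _ => ?_
  rw [Finset.mul_sum]
  refine Finset.sum_congr rfl fun y _ => ?_
  ring

omit [DecidableEq V] [LinearOrder R] [IsStrictOrderedRing R] in
/-- **The bilinear form of the (3M1) kernel** at `q = q′ = p` is twice the (3M1)-slack. -/
theorem biForm_threeMarkOneKernel (p : E → R) (ends : E → Sym2 V) (a₁ a₂ b o v : V) :
    biForm p p (threeMarkOneKernel ends a₁ a₂ b o v) =
      2 * (cell p ends a₁ a₂ b o v true false true * cell p ends a₁ a₂ b o v false true false +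
          cell p ends a₁ a₂ b o v false false true * cell p ends a₁ a₂ b o v true true false +
          2 * (cell p ends a₁ a₂ b o v true true false * cell p ends a₁ a₂ b o v true false true) -
        (cell p ends a₁ a₂ b o v false true true * cell p ends a₁ a₂ b o v true false false +
          cell p ends a₁ a₂ b o v true true true * cell p ends a₁ a₂ b o v false false false +
          2 * (cell p ends a₁ a₂ b o v true false false * cell p ends a₁ a₂ b o v true true true))) := by
  have e : threeMarkOneKernel ends a₁ a₂ b o v =
      fun x y => threeMarkKernel ends a₁ a₂ b o v x y +
        (fun x y => (2 : R) * classKernel ends a₁ a₂ b o v x y) x y := by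
    funext x y; rfl
  rw [e, biForm_add_kernel, biForm_smul_kernel, biForm_threeMarkKernel, biForm_classKernel]
  ring

/-- **`ThreeMarkOneCount`, the typed (3M1) candidate (NOT claimed proved)**: for every minor `(G, z)`
the complementary-pair count of the (3M1) kernel is nonnegative — the two-copy Bernstein
coefficients of the (3M1) slack are all `≥ 0`.  Census: 0 negative on all 1,980,014,055 abstract
instances with ≤ 9 mixed edges (night-3 g23, §32.15). -/
def ThreeMarkOneCount (R : Type*) [Field R] [LinearOrder R] [IsStrictOrderedRing R]
    (ends : E → Sym2 V) (a₁ a₂ b o v : V) : Prop :=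
  ∀ (G : Finset E) (z : Config E),
    0 ≤ pinnedCount G z (threeMarkOneKernel (R := R) ends a₁ a₂ b o v)

/-- **(3M1) from its typed form**: `ThreeMarkOneCount → ThreeMarkOne` (p1's
`disSum_nonneg_of_pinnedCount` at `F = ∅` with `biForm p p K = 2·slack`). -/
theorem threeMarkOne_of_threeMarkOneCount {ends : E → Sym2 V} {a₁ a₂ b o v : V}
    (hC : ThreeMarkOneCount R ends a₁ a₂ b o v) :
    PointSplit.ThreeMarkOne (R := R) ends a₁ a₂ b o v := by
  intro p hp
  have hd := disSum_nonneg_of_pinnedCount (threeMarkOneKernel (R := R) ends a₁ a₂ b o v) hC p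
    (fun e => ⟨hp.nonneg e, hp.le_one e⟩) ∅
  rw [disSum_empty, biForm_threeMarkOneKernel] at hd
  linarith [hd]

end RootEdge

end CovForm

end Summit.Ventures.PercRepro2
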